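import Summits.HodgeConjecture.HodgeConjecture.Theorems.F0P3cStCharTSCartanEllH   -- ★ (this seat) p851732 «CARTAN-ELL-H ⟸ CARTAN-FIN rank 2»: `cartanEllH_of_cartanFin_two`
import Literature.NumberTheory.Rogawski1990.UnitaryCartanClassesFinite          -- ★ (B7a) p851679 `exists_finset_cartanSubgroups_of_types_of_norms` (F0P3a-p03 g24; any rank `N`)
import Literature.NumberTheory.Rogawski1990.CartanNormClassesFinite             -- ★ (B7a′) p851686 `exists_finset_norm_classes` (over ★ (B6) p851678, this seat)
import Literature.NumberTheory.Rogawski1990.CartanAlgebraTypesFinite           -- ★ (B7a-S) `exists_finset_cartanAlgebra_types_unitaryGroup` (F0P3a-p04 g26)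
import Literature.NumberTheory.LocalFields.FiniteSubextensions                   -- ★ `LocalField.finite_setOf_intermediateField_finrank_le` (Krasner finiteness at `L⁺_v`)
import Literature.GroupTheory.CentralizerClassesTransport                       -- ★ (B7b-pre) p851693 `exists_finset_centralizers_of_mulEquiv`
import Literature.NumberTheory.Rogawski1990.LocalNormFibreSurjectiveNonsplit    -- ★ `charpoly_localNonsplitEquiv` (one-place model, any rank `N`)
import Literature.NumberTheory.Rogawski1990.TypeThreeCubicTorusNonsplit         -- ★ `bijective_evalRingHom_of_nonsplit`
import Literature.NumberTheory.LocalFields.QuadraticLocalNormFixedRange         -- ★ `galAdicCompletionMap_algebraMap_place`, `IsCMField.exists_algebraMap_place_eq`, `finrank` two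
import Literature.NumberTheory.Rogawski1990.UnitaryVertexStabilizerCoverCM      -- ★ `galAdicCompletionMap_involutive`, `placeForm_map_transpose_of_hermitian`
import Literature.NumberTheory.Automorphic.AdicCompletionLocalField             -- ★ `IsNonarchimedeanLocalField (v.adicCompletion K)`
import Literature.NumberTheory.Automorphic.LocalUnitaryGroupCongr               -- ★ `antidiagOne_isHermitian`, `isUnit_antidiagOne_det`, `isUnit_placeForm_of_isUnit_det`
import Summits.HodgeConjecture.HodgeConjecture.Theorems.F0P3cStCharTSHFields     -- ★ p851472 (F0P2-p01 g21) (P5) `cartanH_pins_of_cartanEllH` (ED. 2, §4)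
import HarnessLib

/-!
# F0 · P3c · line LH6 «StCharTS» — «CARTAN-FIN at rank 2» and «CARTAN-ELL-H★»: finitely many `U(Φ₂)(L⁺_v)`-conjugacy classes of Cartan subgroups, and the
# (P5) ∃-fact «CARTAN-ELL-H» of the §12.5 datum road UNCONDITIONALLY (MAP v5 §3 row `cartanH μTH`: RUNG0 HYPOTHESIS → THEOREM)

Cell `pub/hodgecm-mathlib`, FLOOR 0, crux H413 = stmt-HodgeConjecture-24833, SUPPORTS-ONLY lane (`--kind proof --supports stmt-HodgeConjecture-24833 --as helper`),
prover seat F0P2-p01 (g22), 2026-09-02.  THEOREMS ONLY; ★-only imports.  Touches no registry and no served Line; count-neutral (it replaces a PARAMETER∕HYPOTHESIS of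
the rung-0 assembler by a construction, not a printed citation of the books).

WHAT.  The rank-2 twin of F0P3a-p03 (g24)'s «CARTAN-FIN (N1)★» (`Theorems/F0P3cStCharTSCartanFin.lean`, rank 3): at a finite place `v` of `L⁺` NON-SPLIT in the CM field `L`
(`w ∣ v` fixed by complex conjugation), the Cartan subgroups `Z(a)` (`a` regular semisimple) of `U(Φ₂)(L⁺_v)` fall into FINITELY MANY conjugacy classes
(`exists_finset_cartanSubgroups_two`), by the SAME ★ chain at `N = 2`: one-place letters (§1; `Φ₂` hermitian with unit determinant: ★ `antidiagOne_isHermitian`,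
★ `isUnit_antidiagOne_det`), ★ (B7a-S) finiteness of involutive Cartan-algebra types at the one-place model (Krasner), ★ (B7a) assembly with (NORMS) := ★ (B7a′) (square
classes, ★ (B6)), transported along ★ `localNonsplitEquiv` by ★ (B7b-pre) with the rank-`N` ★ `charpoly_localNonsplitEquiv` (§2 `isRegularElt_iff_separable_localNonsplitEquiv_two`).
Then ★ p851732 `cartanEllH_of_cartanFin_two` gives **`cartanEllH`**: the hypothesis `hCartEllH` of ★ p851472 `F0P3cStCharTSHFields.cartanH_pins_of_cartanEllH` VERBATIM — compact
Cartan representatives `Z_H(γ₀)` of `H_v = U(Φ₂)(L⁺_v) × U(Φ₁)(L⁺_v)`, `γ₀` `G`-regular, Haar PROBABILITY measures, completeness, pairwise non-conjugacy — from `hns` ALONE.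

* §1 `onePlace_letters_two` — the seven one-place letters at `(L⁺_v, L_w, σ_w, (Φ₂)_w)`.
* §2 `isRegularElt_iff_separable_localNonsplitEquiv_two`; `cartanAlgebra_types_onePlace_two` (★ (B7a-S) at the letters); `exists_finset_cartanSubgroups_of_types_two`;
  **`exists_finset_cartanSubgroups_two`** (unconditional).
* §3 **`cartanEllH`** — THE H-SIDE ∃-FACT, unconditional at non-split `v`; `cartanH_pins` — the (P5)∕S12a structure hypotheses for every datum pinned to it (★ `cartanH_pins_of_cartanEllH`).

HONEST LABEL: HC_CM is proved only modulo the 7 printed citations (2 remaining named inputs: hLiu418 = stmt-HodgeConjecture-24832,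
h413 = stmt-HodgeConjecture-24833) until rung 0 closes; this file discharges the H-side RUNG0 hypothesis «CARTAN-ELL-H» of the LH6 organ (S-𝔇), nothing of the books.

## References
* [Rogawski1990] J. D. Rogawski, *Automorphic Representations of Unitary Groups in Three Variables*, Ann. of Math. Stud. 123 (1990):
  §3.6 pp. 28–29 (classification of Cartan subgroups), §4.3 p. 42 (`G`-regular elements of `H`), §12.5 pp. 182, 184 (elliptic tori of `H`, normalised measures).
* [PlatonovRapinchuk1994] V. Platonov, A. Rapinchuk, *Algebraic Groups and Number Theory* (1994), §6.4 Cor. 1 (finitely many conjugacy classes of maximal tori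
  over a local field), §5.1 (one-place models).
-/

set_option autoImplicit false
-- the mandated namespace repeats `HodgeConjecture.HodgeConjecture`, as in every `Theorems/*.lean` of this sub-problem
set_option linter.dupNamespace false

noncomputable section

open NumberField IsDedekindDomain Polynomial MeasureTheory
open scoped Matrix MatrixGroups
open Literature.NumberTheory.Rogawski1990 Literature.NumberTheory.Automorphic Literature.NumberTheory.Automorphic.UnitaryGroup
open Literature.NumberTheory.GaloisRepresentations Literature.NumberTheory.LocalFields Literature.GroupTheory
open Literature.AlgebraicGeometry.ShimuraVarieties (unitaryGroup mem_unitaryGroup_iff)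
open Literature.NumberTheory.Rogawski1990.TypeThreeTorus (bijective_evalRingHom_of_nonsplit)
open Summit.HodgeConjecture.HodgeConjecture.Cruxes.H413.F0P3cStCharTSCartanEllH (cartanEllH_of_cartanFin_two)
open Literature.NumberTheory.Rogawski1990.Ch12Sec5
open Summit.HodgeConjecture.HodgeConjecture.Cruxes.H413

namespace Summit.HodgeConjecture.HodgeConjecture.Cruxes.H413.F0P3cStCharTSCartanFinTwo

/-! ## §1 The one-place letters at rank 2 -/

section OnePlace

variable (L : Type) [Field L] [NumberField L] [IsCMField L] {v : HeightOneSpectrum (𝓞 ↥(maximalRealSubfield L))}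
  (w : PlacesOver L v) (hw : IsCMField.complexConj L • w.1 = w.1)

include hw in
/-- **The one-place letters at rank 2** (`(L⁺_v, L_w, σ_w, (Φ₂)_w)`): `σ_w` fixes `L⁺_v`; `σ_w² = 1`; `Fix(σ_w) ⊆ L⁺_v`; `2 ≠ 0`; `σ_w ≠ 1`; `det (Φ₂)_w` a unit;
`(Φ₂)_w` is `σ_w`-hermitian (the rank-3 letters of ★ `F0P3cStCharTSCartanFin.onePlace_letters` with `Φ₂` for `Φ₃`). [cite: Rogawski1990, §3.6 pp. 28–29; §1.9 p. 8] -/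
theorem onePlace_letters_two :
    (∀ q : v.adicCompletion ↥(maximalRealSubfield L), (galAdicCompletionMap (L := L) (IsCMField.complexConj L) hw)
        (algebraMap (v.adicCompletion ↥(maximalRealSubfield L)) (w.1.adicCompletion L) q) = algebraMap (v.adicCompletion ↥(maximalRealSubfield L)) (w.1.adicCompletion L) q) ∧
    (∀ x : w.1.adicCompletion L, (galAdicCompletionMap (L := L) (IsCMField.complexConj L) hw) ((galAdicCompletionMap (L := L) (IsCMField.complexConj L) hw) x) = x) ∧
    (∀ x : w.1.adicCompletion L, (galAdicCompletionMap (L := L) (IsCMField.complexConj L) hw) x = x →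
        ∃ q : v.adicCompletion ↥(maximalRealSubfield L), algebraMap (v.adicCompletion ↥(maximalRealSubfield L)) (w.1.adicCompletion L) q = x) ∧
    ((2 : w.1.adicCompletion L) ≠ 0) ∧
    (∃ ℓ : w.1.adicCompletion L, (galAdicCompletionMap (L := L) (IsCMField.complexConj L) hw) ℓ ≠ ℓ) ∧
    IsUnit (placeForm (Matrix.of fun i j : Fin 2 => if i.val + j.val + 1 = 2 then (1 : L) else 0) w.1).det ∧
    ((placeForm (Matrix.of fun i j : Fin 2 => if i.val + j.val + 1 = 2 then (1 : L) else 0) w.1).map (galAdicCompletionMap (L := L) (IsCMField.complexConj L) hw))ᵀ = placeForm (Matrix.of fun i j : Fin 2 => if i.val + j.val + 1 = 2 then (1 : L) else 0) w.1 := by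
  refine ⟨fun q => galAdicCompletionMap_algebraMap_place w (IsCMField.complexConj L) hw q, galAdicCompletionMap_involutive L v w hw,
    fun x hx => IsCMField.exists_algebraMap_place_eq L w hw hx, two_ne_zero, ?_,
    (Matrix.isUnit_iff_isUnit_det _).1 (isUnit_placeForm_of_isUnit_det (isUnit_antidiagOne_det L 2) w.1),
    placeForm_map_transpose_of_hermitian L v w hw (Matrix.of fun i j : Fin 2 => if i.val + j.val + 1 = 2 then (1 : L) else 0) (antidiagOne_isHermitian L 2)⟩
  -- `σ_w ≠ 1`: complex conjugation moves some `x ∈ L`, and `L → L_w` is injective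
  obtain ⟨x, hx⟩ := DFunLike.ne_iff.1 (IsCMField.complexConj_ne_one L)
  refine ⟨((x : L) : w.1.adicCompletion L), fun h => hx ?_⟩
  rw [galAdicCompletionMap_coe_algEquiv] at h
  exact (algebraMap L (w.1.adicCompletion L)).injective h

end OnePlace

/-! ## §2 Finitely many conjugacy classes of Cartan subgroups of `U(Φ₂)(L⁺_v)` -/

section Main

variable (L : Type) [Field L] [NumberField L] [IsCMField L] (v : HeightOneSpectrum (𝓞 ↥(maximalRealSubfield L)))

/-- **Regularity on both sides of the rank-2 one-place model**: `IsRegularElt a ↔ charpoly (e a)` separable, `e = localNonsplitEquiv` (`→` `Separable.map`; `←` because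
`eval_w : ∏ L_w′ → L_w` is a ring isomorphism at a non-split place, ★ `bijective_evalRingHom_of_nonsplit`; the rank-3 twin is ★ `isRegularElt_iff_separable_localNonsplitEquiv`).
[cite: Rogawski1990, §3.1 p. 19] [cite: PlatonovRapinchuk1994, §5.1] -/
theorem isRegularElt_iff_separable_localNonsplitEquiv_two (w : PlacesOver L v) (hw : IsCMField.complexConj L • w.1 = w.1) (γ : (UnitaryGroup.cmDatum L 2 (Matrix.of fun i j : Fin 2 => if i.val + j.val + 1 = 2 then (1 : L) else 0)).Local v) :
    IsRegularElt (γ.val : GL (Fin 2) (LocalRing L v)) ↔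
      (((localNonsplitEquiv (IsCMField.complexConj L) (Matrix.of fun i j : Fin 2 => if i.val + j.val + 1 = 2 then (1 : L) else 0) (IsCMField.complexConj_ne_one L) w hw γ :
          ↥(unitaryGroupOfForm (galAdicCompletionMap (L := L) (IsCMField.complexConj L) hw) (placeForm (Matrix.of fun i j : Fin 2 => if i.val + j.val + 1 = 2 then (1 : L) else 0) w.1))) :
            GL (Fin 2) (w.1.adicCompletion L)) : Matrix (Fin 2) (Fin 2) (w.1.adicCompletion L)).charpoly.Separable := by
  rw [charpoly_localNonsplitEquiv (L := L) (v := v) (w := w) (hw := hw) (H := (Matrix.of fun i j : Fin 2 => if i.val + j.val + 1 = 2 then (1 : L) else 0)) γ, isRegularElt_iff]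
  constructor
  · exact fun h => h.map
  · intro h
    set ev : LocalRing L v →+* w.1.adicCompletion L := Pi.evalRingHom (fun w' : PlacesOver L v => w'.1.adicCompletion L) w with hev
    set P : (LocalRing L v)[X] := ((γ.val : GL (Fin 2) (LocalRing L v)) : Matrix (Fin 2) (Fin 2) (LocalRing L v)).charpoly with hP
    let φ : LocalRing L v ≃+* w.1.adicCompletion L := RingEquiv.ofBijective ev (bijective_evalRingHom_of_nonsplit L w hw)
    have hφ : (φ : LocalRing L v →+* w.1.adicCompletion L) = ev := RingHom.ext fun _ => rfl
    have hp : P = (P.map ev).map (φ.symm : w.1.adicCompletion L →+* LocalRing L v) := by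
      rw [← hφ, Polynomial.map_map, RingEquiv.symm_comp, Polynomial.map_id]
    rw [hp]
    exact h.map

/-- **Finiteness of involutive Cartan-algebra TYPES at the rank-2 one-place model** (★ (B7a-S) `exists_finset_cartanAlgebra_types_unitaryGroup` at the §1 letters, with the Krasner
finiteness ★ `LocalField.finite_setOf_intermediateField_finrank_le` at `L⁺_v`). [cite: Rogawski1990, §3.6 pp. 28–29] [cite: PlatonovRapinchuk1994, §6.4 Cor. 1] -/
theorem cartanAlgebra_types_onePlace_two (w : PlacesOver L v) (hw : IsCMField.complexConj L • w.1 = w.1) :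
    ∃ Γ : Finset ↥(unitaryGroup (galAdicCompletionMap (L := L) (IsCMField.complexConj L) hw) (placeForm (Matrix.of fun i j : Fin 2 => if i.val + j.val + 1 = 2 then (1 : L) else 0) w.1)),
      ∀ (γ : ↥(unitaryGroup (galAdicCompletionMap (L := L) (IsCMField.complexConj L) hw) (placeForm (Matrix.of fun i j : Fin 2 => if i.val + j.val + 1 = 2 then (1 : L) else 0) w.1)))
        (hreg : ((γ : GL (Fin 2) (w.1.adicCompletion L)) : Matrix (Fin 2) (Fin 2) (w.1.adicCompletion L)).charpoly.Separable),
        ∃ γ₀ ∈ Γ, ∃ hreg₀ : ((γ₀ : GL (Fin 2) (w.1.adicCompletion L)) : Matrix (Fin 2) (Fin 2) (w.1.adicCompletion L)).charpoly.Separable,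
          ∃ Ψ : ↥(Algebra.adjoin (w.1.adicCompletion L) ({((γ₀ : GL (Fin 2) (w.1.adicCompletion L)) : Matrix (Fin 2) (Fin 2) (w.1.adicCompletion L))} : Set (Matrix (Fin 2) (Fin 2) (w.1.adicCompletion L)))) ≃ₐ[w.1.adicCompletion L]
              ↥(Algebra.adjoin (w.1.adicCompletion L) ({((γ : GL (Fin 2) (w.1.adicCompletion L)) : Matrix (Fin 2) (Fin 2) (w.1.adicCompletion L))} : Set (Matrix (Fin 2) (Fin 2) (w.1.adicCompletion L)))),
            ∀ b, Ψ (cartanInvolution (F := v.adicCompletion ↥(maximalRealSubfield L)) (galAdicCompletionMap (L := L) (IsCMField.complexConj L) hw) (onePlace_letters_two L w hw).1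
                (onePlace_letters_two L w hw).2.1 (onePlace_letters_two L w hw).2.2.2.2.2.1 (onePlace_letters_two L w hw).2.2.2.2.2.2 hreg₀ (mem_unitaryGroup_iff.1 γ₀.2) b) =
              cartanInvolution (F := v.adicCompletion ↥(maximalRealSubfield L)) (galAdicCompletionMap (L := L) (IsCMField.complexConj L) hw) (onePlace_letters_two L w hw).1
                (onePlace_letters_two L w hw).2.1 (onePlace_letters_two L w hw).2.2.2.2.2.1 (onePlace_letters_two L w hw).2.2.2.2.2.2 hreg (mem_unitaryGroup_iff.1 γ.2) (Ψ b) :=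
  exists_finset_cartanAlgebra_types_unitaryGroup (F := v.adicCompletion ↥(maximalRealSubfield L)) (galAdicCompletionMap (L := L) (IsCMField.complexConj L) hw)
    (onePlace_letters_two L w hw).1 (onePlace_letters_two L w hw).2.1 (onePlace_letters_two L w hw).2.2.1 (onePlace_letters_two L w hw).2.2.2.1
    (onePlace_letters_two L w hw).2.2.2.2.1 (onePlace_letters_two L w hw).2.2.2.2.2.1 (onePlace_letters_two L w hw).2.2.2.2.2.2
    (LocalField.finite_setOf_intermediateField_finrank_le (v.adicCompletion ↥(maximalRealSubfield L)))

/-- **CARTAN-FIN at rank 2, modulo TYPES**: given the finiteness of involutive Cartan-algebra types at the one-place model `U(σ_w, (Φ₂)_w)(L_w)`, finitely many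
`U(Φ₂)(L⁺_v)`-conjugacy classes of Cartan subgroups `Z(a)`, `a` regular (★ (B7a) with (NORMS) := ★ (B7a′); transport ★ (B7b-pre) along ★ `localNonsplitEquiv`).
[cite: Rogawski1990, §3.6 pp. 28–29] [cite: PlatonovRapinchuk1994, §6.4 Cor. 1] -/
theorem exists_finset_cartanSubgroups_of_types_two (w : PlacesOver L v) (hw : IsCMField.complexConj L • w.1 = w.1)
    (hTypes : ∃ Γ : Finset ↥(unitaryGroup (galAdicCompletionMap (L := L) (IsCMField.complexConj L) hw) (placeForm (Matrix.of fun i j : Fin 2 => if i.val + j.val + 1 = 2 then (1 : L) else 0) w.1)),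
      ∀ (γ : ↥(unitaryGroup (galAdicCompletionMap (L := L) (IsCMField.complexConj L) hw) (placeForm (Matrix.of fun i j : Fin 2 => if i.val + j.val + 1 = 2 then (1 : L) else 0) w.1)))
        (hreg : ((γ : GL (Fin 2) (w.1.adicCompletion L)) : Matrix (Fin 2) (Fin 2) (w.1.adicCompletion L)).charpoly.Separable),
        ∃ γ₀ ∈ Γ, ∃ hreg₀ : ((γ₀ : GL (Fin 2) (w.1.adicCompletion L)) : Matrix (Fin 2) (Fin 2) (w.1.adicCompletion L)).charpoly.Separable,
          ∃ Ψ : ↥(Algebra.adjoin (w.1.adicCompletion L) ({((γ₀ : GL (Fin 2) (w.1.adicCompletion L)) : Matrix (Fin 2) (Fin 2) (w.1.adicCompletion L))} : Set (Matrix (Fin 2) (Fin 2) (w.1.adicCompletion L)))) ≃ₐ[w.1.adicCompletion L]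
              ↥(Algebra.adjoin (w.1.adicCompletion L) ({((γ : GL (Fin 2) (w.1.adicCompletion L)) : Matrix (Fin 2) (Fin 2) (w.1.adicCompletion L))} : Set (Matrix (Fin 2) (Fin 2) (w.1.adicCompletion L)))),
            ∀ b, Ψ (cartanInvolution (F := v.adicCompletion ↥(maximalRealSubfield L)) (galAdicCompletionMap (L := L) (IsCMField.complexConj L) hw) (onePlace_letters_two L w hw).1
                (onePlace_letters_two L w hw).2.1 (onePlace_letters_two L w hw).2.2.2.2.2.1 (onePlace_letters_two L w hw).2.2.2.2.2.2 hreg₀ (mem_unitaryGroup_iff.1 γ₀.2) b) =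
              cartanInvolution (F := v.adicCompletion ↥(maximalRealSubfield L)) (galAdicCompletionMap (L := L) (IsCMField.complexConj L) hw) (onePlace_letters_two L w hw).1
                (onePlace_letters_two L w hw).2.1 (onePlace_letters_two L w hw).2.2.2.2.2.1 (onePlace_letters_two L w hw).2.2.2.2.2.2 hreg (mem_unitaryGroup_iff.1 γ.2) (Ψ b)) :
    ∃ S : Finset (Subgroup ((UnitaryGroup.cmDatum L 2 (Matrix.of fun i j : Fin 2 => if i.val + j.val + 1 = 2 then (1 : L) else 0)).Local v)),
      (∀ T ∈ S, ∃ γ₀ : (UnitaryGroup.cmDatum L 2 (Matrix.of fun i j : Fin 2 => if i.val + j.val + 1 = 2 then (1 : L) else 0)).Local v, IsRegularElt (γ₀.val : GL (Fin 2) (LocalRing L v)) ∧ T = Subgroup.centralizer ({γ₀} : Set ((UnitaryGroup.cmDatum L 2 (Matrix.of fun i j : Fin 2 => if i.val + j.val + 1 = 2 then (1 : L) else 0)).Local v))) ∧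
      ∀ γ : (UnitaryGroup.cmDatum L 2 (Matrix.of fun i j : Fin 2 => if i.val + j.val + 1 = 2 then (1 : L) else 0)).Local v, IsRegularElt (γ.val : GL (Fin 2) (LocalRing L v)) →
        ∃ T ∈ S, ∃ u : (UnitaryGroup.cmDatum L 2 (Matrix.of fun i j : Fin 2 => if i.val + j.val + 1 = 2 then (1 : L) else 0)).Local v, Subgroup.centralizer ({γ} : Set ((UnitaryGroup.cmDatum L 2 (Matrix.of fun i j : Fin 2 => if i.val + j.val + 1 = 2 then (1 : L) else 0)).Local v)) = T.map (MulAut.conj u).toMonoidHom := by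
  obtain ⟨hσF, hσσ, hFix, h2, hex, hHdet, hH⟩ := onePlace_letters_two L w hw
  have hone := exists_finset_cartanSubgroups_of_types_of_norms (F := v.adicCompletion ↥(maximalRealSubfield L))
    (galAdicCompletionMap (L := L) (IsCMField.complexConj L) hw) hσF hσσ hHdet hH hTypes
    (fun γ₀ hreg₀ => exists_finset_norm_classes (F := v.adicCompletion ↥(maximalRealSubfield L))
      (galAdicCompletionMap (L := L) (IsCMField.complexConj L) hw) hσF hσσ hHdet hH γ₀ hreg₀)
  let e₁ := localNonsplitEquiv (IsCMField.complexConj L) (Matrix.of fun i j : Fin 2 => if i.val + j.val + 1 = 2 then (1 : L) else 0) (IsCMField.complexConj_ne_one L) w hw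
  have hUU : unitaryGroupOfForm (galAdicCompletionMap (L := L) (IsCMField.complexConj L) hw) (placeForm (Matrix.of fun i j : Fin 2 => if i.val + j.val + 1 = 2 then (1 : L) else 0) w.1) =
      unitaryGroup (galAdicCompletionMap (L := L) (IsCMField.complexConj L) hw) (placeForm (Matrix.of fun i j : Fin 2 => if i.val + j.val + 1 = 2 then (1 : L) else 0) w.1) := Subgroup.ext fun _ => Iff.rfl
  let e : (UnitaryGroup.cmDatum L 2 (Matrix.of fun i j : Fin 2 => if i.val + j.val + 1 = 2 then (1 : L) else 0)).Local v ≃* ↥(unitaryGroup (galAdicCompletionMap (L := L) (IsCMField.complexConj L) hw) (placeForm (Matrix.of fun i j : Fin 2 => if i.val + j.val + 1 = 2 then (1 : L) else 0) w.1)) :=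
    e₁.toMulEquiv.trans (MulEquiv.subgroupCongr hUU)
  refine exists_finset_centralizers_of_mulEquiv e (P := fun γ : (UnitaryGroup.cmDatum L 2 (Matrix.of fun i j : Fin 2 => if i.val + j.val + 1 = 2 then (1 : L) else 0)).Local v => IsRegularElt (γ.val : GL (Fin 2) (LocalRing L v)))
    (P' := fun γ' => ((γ' : GL (Fin 2) (w.1.adicCompletion L)) : Matrix (Fin 2) (Fin 2) (w.1.adicCompletion L)).charpoly.Separable) (fun γ => ?_) hone
  exact isRegularElt_iff_separable_localNonsplitEquiv_two L v w hw γ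

/-- **«CARTAN-FIN at rank 2» — FINITELY MANY CONJUGACY CLASSES OF CARTAN SUBGROUPS of `U(Φ₂)(L⁺_v)`** (`v` non-split in `L`), unconditional: the hypothesis `hfin2` of ★
`cartanEllH_of_cartanFin_two`. [cite: Rogawski1990, §3.6 pp. 28–29] [cite: PlatonovRapinchuk1994, §6.4 Cor. 1] -/
theorem exists_finset_cartanSubgroups_two (hns : ∀ w : PlacesOver L v, IsCMField.complexConj L • w.1 = w.1) :
    ∃ S : Finset (Subgroup ((UnitaryGroup.cmDatum L 2 (Matrix.of fun i j : Fin 2 => if i.val + j.val + 1 = 2 then (1 : L) else 0)).Local v)),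
      (∀ T ∈ S, ∃ γ₀ : (UnitaryGroup.cmDatum L 2 (Matrix.of fun i j : Fin 2 => if i.val + j.val + 1 = 2 then (1 : L) else 0)).Local v, IsRegularElt (γ₀.val : GL (Fin 2) (LocalRing L v)) ∧ T = Subgroup.centralizer ({γ₀} : Set ((UnitaryGroup.cmDatum L 2 (Matrix.of fun i j : Fin 2 => if i.val + j.val + 1 = 2 then (1 : L) else 0)).Local v))) ∧
      ∀ γ : (UnitaryGroup.cmDatum L 2 (Matrix.of fun i j : Fin 2 => if i.val + j.val + 1 = 2 then (1 : L) else 0)).Local v, IsRegularElt (γ.val : GL (Fin 2) (LocalRing L v)) →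
        ∃ T ∈ S, ∃ u : (UnitaryGroup.cmDatum L 2 (Matrix.of fun i j : Fin 2 => if i.val + j.val + 1 = 2 then (1 : L) else 0)).Local v, Subgroup.centralizer ({γ} : Set ((UnitaryGroup.cmDatum L 2 (Matrix.of fun i j : Fin 2 => if i.val + j.val + 1 = 2 then (1 : L) else 0)).Local v)) = T.map (MulAut.conj u).toMonoidHom := by
  obtain ⟨w⟩ := (inferInstance : Nonempty (PlacesOver L v))
  exact exists_finset_cartanSubgroups_of_types_two L v w (hns w) (cartanAlgebra_types_onePlace_two L v w (hns w))

/-! ## §3 «CARTAN-ELL-H★» — the (P5) ∃-fact of the datum road, UNCONDITIONAL at non-split `v` -/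

/-- **«CARTAN-ELL-H★».**  At a finite place `v` of `L⁺` non-split in the CM field `L`, the endoscopic group `H_v = U(Φ₂)(L⁺_v) × U(Φ₁)(L⁺_v)` has a FINITE set `SH`
of COMPACT Cartan subgroups `Z_H(γ₀)`, `γ₀` `G`-regular, each with a Haar PROBABILITY measure `μTHf T` (print's «meas = 1»), COMPLETE up to `H_v`-conjugacy among the compact
`Z_H(γ₀)` and pairwise NON-conjugate — the hypothesis `hCartEllH` of ★ `F0P3cStCharTSHFields.cartanH_pins_of_cartanEllH` VERBATIM, hence the MAP v5 §3 row `cartanH μTH`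
(«CARTAN-ELL-H ∃-fact — RUNG0 HYPOTHESIS») is a THEOREM (★ `cartanEllH_of_cartanFin_two` ∘ `exists_finset_cartanSubgroups_two`).
[cite: Rogawski1990, §3.6 pp. 28–29; §12.5 p. 184] [cite: PlatonovRapinchuk1994, §6.4 Cor. 1] -/
theorem cartanEllH
    [MeasurableSpace ((UnitaryGroup.cmDatum L 2 (Matrix.of fun i j : Fin 2 => if i.val + j.val + 1 = 2 then (1 : L) else 0)).Local v ×
        (UnitaryGroup.cmDatum L 1 (Matrix.of fun i j : Fin 1 => if i.val + j.val + 1 = 1 then (1 : L) else 0)).Local v)]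
    [BorelSpace ((UnitaryGroup.cmDatum L 2 (Matrix.of fun i j : Fin 2 => if i.val + j.val + 1 = 2 then (1 : L) else 0)).Local v ×
        (UnitaryGroup.cmDatum L 1 (Matrix.of fun i j : Fin 1 => if i.val + j.val + 1 = 1 then (1 : L) else 0)).Local v)]
    (hns : ∀ w : PlacesOver L v, IsCMField.complexConj L • w.1 = w.1) :
        ∃ (SH : Finset (Subgroup ((UnitaryGroup.cmDatum L 2 (Matrix.of fun i j : Fin 2 => if i.val + j.val + 1 = 2 then (1 : L) else 0)).Local v ×
        (UnitaryGroup.cmDatum L 1 (Matrix.of fun i j : Fin 1 => if i.val + j.val + 1 = 1 then (1 : L) else 0)).Local v)))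
        (μTHf : (T : Subgroup ((UnitaryGroup.cmDatum L 2 (Matrix.of fun i j : Fin 2 => if i.val + j.val + 1 = 2 then (1 : L) else 0)).Local v ×
        (UnitaryGroup.cmDatum L 1 (Matrix.of fun i j : Fin 1 => if i.val + j.val + 1 = 1 then (1 : L) else 0)).Local v)) → Measure ↥T),
      (∀ T ∈ SH, IsCompact (T : Set ((UnitaryGroup.cmDatum L 2 (Matrix.of fun i j : Fin 2 => if i.val + j.val + 1 = 2 then (1 : L) else 0)).Local v ×
        (UnitaryGroup.cmDatum L 1 (Matrix.of fun i j : Fin 1 => if i.val + j.val + 1 = 1 then (1 : L) else 0)).Local v)) ∧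
        (∃ γ₀ : (UnitaryGroup.cmDatum L 2 (Matrix.of fun i j : Fin 2 => if i.val + j.val + 1 = 2 then (1 : L) else 0)).Local v ×
        (UnitaryGroup.cmDatum L 1 (Matrix.of fun i j : Fin 1 => if i.val + j.val + 1 = 1 then (1 : L) else 0)).Local v, IsLocalGRegular L v γ₀ ∧ T = Subgroup.centralizer ({γ₀} : Set ((UnitaryGroup.cmDatum L 2 (Matrix.of fun i j : Fin 2 => if i.val + j.val + 1 = 2 then (1 : L) else 0)).Local v ×
        (UnitaryGroup.cmDatum L 1 (Matrix.of fun i j : Fin 1 => if i.val + j.val + 1 = 1 then (1 : L) else 0)).Local v))) ∧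
        (μTHf T).IsHaarMeasure ∧ IsProbabilityMeasure (μTHf T)) ∧
      (∀ γ₀ : (UnitaryGroup.cmDatum L 2 (Matrix.of fun i j : Fin 2 => if i.val + j.val + 1 = 2 then (1 : L) else 0)).Local v ×
        (UnitaryGroup.cmDatum L 1 (Matrix.of fun i j : Fin 1 => if i.val + j.val + 1 = 1 then (1 : L) else 0)).Local v, IsLocalGRegular L v γ₀ →
        IsCompact ((Subgroup.centralizer ({γ₀} : Set ((UnitaryGroup.cmDatum L 2 (Matrix.of fun i j : Fin 2 => if i.val + j.val + 1 = 2 then (1 : L) else 0)).Local v ×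
        (UnitaryGroup.cmDatum L 1 (Matrix.of fun i j : Fin 1 => if i.val + j.val + 1 = 1 then (1 : L) else 0)).Local v)) :
            Subgroup ((UnitaryGroup.cmDatum L 2 (Matrix.of fun i j : Fin 2 => if i.val + j.val + 1 = 2 then (1 : L) else 0)).Local v ×
        (UnitaryGroup.cmDatum L 1 (Matrix.of fun i j : Fin 1 => if i.val + j.val + 1 = 1 then (1 : L) else 0)).Local v)) :
          Set ((UnitaryGroup.cmDatum L 2 (Matrix.of fun i j : Fin 2 => if i.val + j.val + 1 = 2 then (1 : L) else 0)).Local v ×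
        (UnitaryGroup.cmDatum L 1 (Matrix.of fun i j : Fin 1 => if i.val + j.val + 1 = 1 then (1 : L) else 0)).Local v)) →
        ∃ T ∈ SH, ∃ x : (UnitaryGroup.cmDatum L 2 (Matrix.of fun i j : Fin 2 => if i.val + j.val + 1 = 2 then (1 : L) else 0)).Local v ×
        (UnitaryGroup.cmDatum L 1 (Matrix.of fun i j : Fin 1 => if i.val + j.val + 1 = 1 then (1 : L) else 0)).Local v,
          Subgroup.centralizer ({x * γ₀ * x⁻¹} : Set ((UnitaryGroup.cmDatum L 2 (Matrix.of fun i j : Fin 2 => if i.val + j.val + 1 = 2 then (1 : L) else 0)).Local v ×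
        (UnitaryGroup.cmDatum L 1 (Matrix.of fun i j : Fin 1 => if i.val + j.val + 1 = 1 then (1 : L) else 0)).Local v)) = T) ∧
      (∀ T ∈ SH, ∀ T' ∈ SH, (∃ x : (UnitaryGroup.cmDatum L 2 (Matrix.of fun i j : Fin 2 => if i.val + j.val + 1 = 2 then (1 : L) else 0)).Local v ×
        (UnitaryGroup.cmDatum L 1 (Matrix.of fun i j : Fin 1 => if i.val + j.val + 1 = 1 then (1 : L) else 0)).Local v, T.map (MulAut.conj x).toMonoidHom = T') → T = T') :=
  cartanEllH_of_cartanFin_two L v hns (exists_finset_cartanSubgroups_two L v hns)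


/-! ## §4 (ED. 2) The (P5) ∕ S12a structure pins for every datum pinned to the constructed representatives -/

/-- **(P5) pins, unconditional**: at non-split `v` there are `SH`, `μTHf` (those of `cartanEllH`) such that EVERY §12.5 datum `𝔇` with `𝔇.cartanH = SH` and `𝔇.μTH = μTHf` satisfies
the (P5)∕S12a structure hypotheses — each `T ∈ 𝔇.cartanH` compact, `= Z_H(γ₀)` with `γ₀` `G`-regular, `𝔇.μTH T` Haar and finite (★ `cartanH_pins_of_cartanEllH` ∘ `cartanEllH`).
[cite: Rogawski1990, §3.6 pp. 28–29; §12.5 p. 184] -/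
theorem cartanH_pins
    [MeasurableSpace (Gqs L v)]
    [∀ γ : Gqs L v, MeasurableSpace (Gqs L v ⧸ Subgroup.centralizer ({γ} : Set (Gqs L v)))]
    [MeasurableSpace (Gqs L v ⧸ Subgroup.center (Gqs L v))]
    [MeasurableSpace ((UnitaryGroup.cmDatum L 2 (Matrix.of fun i j : Fin 2 => if i.val + j.val + 1 = 2 then (1 : L) else 0)).Local v ×
        (UnitaryGroup.cmDatum L 1 (Matrix.of fun i j : Fin 1 => if i.val + j.val + 1 = 1 then (1 : L) else 0)).Local v)]
    [BorelSpace ((UnitaryGroup.cmDatum L 2 (Matrix.of fun i j : Fin 2 => if i.val + j.val + 1 = 2 then (1 : L) else 0)).Local v ×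
        (UnitaryGroup.cmDatum L 1 (Matrix.of fun i j : Fin 1 => if i.val + j.val + 1 = 1 then (1 : L) else 0)).Local v)]
    (hns : ∀ w : PlacesOver L v, IsCMField.complexConj L • w.1 = w.1) :
    ∃ (SH : Finset (Subgroup ((UnitaryGroup.cmDatum L 2 (Matrix.of fun i j : Fin 2 => if i.val + j.val + 1 = 2 then (1 : L) else 0)).Local v ×
        (UnitaryGroup.cmDatum L 1 (Matrix.of fun i j : Fin 1 => if i.val + j.val + 1 = 1 then (1 : L) else 0)).Local v)))
        (μTHf : (T : Subgroup ((UnitaryGroup.cmDatum L 2 (Matrix.of fun i j : Fin 2 => if i.val + j.val + 1 = 2 then (1 : L) else 0)).Local v ×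
        (UnitaryGroup.cmDatum L 1 (Matrix.of fun i j : Fin 1 => if i.val + j.val + 1 = 1 then (1 : L) else 0)).Local v)) → Measure ↥T),
      ∀ 𝔇 : EllipticData (Gqs L v) ((UnitaryGroup.cmDatum L 2 (Matrix.of fun i j : Fin 2 => if i.val + j.val + 1 = 2 then (1 : L) else 0)).Local v ×
        (UnitaryGroup.cmDatum L 1 (Matrix.of fun i j : Fin 1 => if i.val + j.val + 1 = 1 then (1 : L) else 0)).Local v),
        𝔇.cartanH = SH → (∀ T, 𝔇.μTH T = μTHf T) →
        ∀ T ∈ 𝔇.cartanH, IsCompact (T : Set ((UnitaryGroup.cmDatum L 2 (Matrix.of fun i j : Fin 2 => if i.val + j.val + 1 = 2 then (1 : L) else 0)).Local v ×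
        (UnitaryGroup.cmDatum L 1 (Matrix.of fun i j : Fin 1 => if i.val + j.val + 1 = 1 then (1 : L) else 0)).Local v)) ∧
          (∃ γ₀ : (UnitaryGroup.cmDatum L 2 (Matrix.of fun i j : Fin 2 => if i.val + j.val + 1 = 2 then (1 : L) else 0)).Local v ×
        (UnitaryGroup.cmDatum L 1 (Matrix.of fun i j : Fin 1 => if i.val + j.val + 1 = 1 then (1 : L) else 0)).Local v, IsLocalGRegular L v γ₀ ∧ T = Subgroup.centralizer ({γ₀} : Set ((UnitaryGroup.cmDatum L 2 (Matrix.of fun i j : Fin 2 => if i.val + j.val + 1 = 2 then (1 : L) else 0)).Local v ×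
        (UnitaryGroup.cmDatum L 1 (Matrix.of fun i j : Fin 1 => if i.val + j.val + 1 = 1 then (1 : L) else 0)).Local v))) ∧
          (𝔇.μTH T).IsHaarMeasure ∧ IsFiniteMeasure (𝔇.μTH T) :=
  F0P3cStCharTSHFields.cartanH_pins_of_cartanEllH L v (cartanEllH L v hns)

end Main

end Summit.HodgeConjecture.HodgeConjecture.Cruxes.H413.F0P3cStCharTSCartanFinTwo

end
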